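import Mathlib.Probability.Moments.Covariance
import Summits.Ventures.YMGap.Thresholds.RegionPoincare
import HarnessLib

/-!
# Venture YMGap — BOUNDARY INSENSITIVITY OF THE DLR KERNELS by exponential tilting, I:
# the tilt identity (OBJECT U, piece U3, file 1 of 3)

HONEST FRAMING: venture file (cell `pub-ymgap`, track (a), seat p2). WHAT THIS IS: the algebra that
turns a covariance bound for ONE DLR kernel `γ_E(·|η) = ymSpecification ρ (Nβ) E η` of 't Hooft-scaled
`SU(N)` lattice Yang–Mills into a bound on the DEPENDENCE of `γ_E(F|η)` on the boundary condition `η`,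
for cylinder observables `F = u((U_e)_{e∈E})`. No differentiation under the integral sign, no path in
`SU(N)`: for two exterior configurations `η, η'` the kernel potentials differ by the TILT
`W = regionPot E η' β - regionPot E η β` and

  `γ_E(F|η') - γ_E(F|η) = Cov_{γ_E(·|η)}(F, e^W) / γ_E(e^W|η)`        (`kernel_integral_sub_eq_cov_div`),

hence `|γ_E(F|η') - γ_E(F|η)| ≤ e^{w} |Cov_{γ_E(·|η)}(F, e^W)|` whenever `|W| ≤ w` on `SU(N)^E`
(`abs_kernel_integral_sub_le`). Also: the kernel expectation of an `E`-cylinder depends on `η` only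
through the links of the COLLAR `((plaquettesTouching E).biUnion plaquetteEdges) \ E`
(`kernel_integral_congr`). Files 2–3 (`RegionBoundaryTiltLipschitz`, `RegionBoundaryInfluence`) bound
the one-link tilt and telescope over the collar. WHAT IT IS NOT: no covariance bound is proved here and
no uniqueness statement.

## References

* H.-O. Georgii, Gibbs Measures and Phase Transitions, 2nd ed. (2011), Ch. 8.
* B. Helffer, J. Funct. Anal. 155 (1998) 571–586 (covariance decay ⇒ decay of boundary influence).
* H. Shen, R. Zhu, X. Zhu, CMP 400 (2023) 805–851, §5 (the mass-gap / uniqueness step being replaced).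
-/

noncomputable section

open scoped Matrix ComplexConjugate BigOperators Matrix.Norms.Frobenius ContDiff Topology ProbabilityTheory
open Matrix Complex Finset MeasureTheory Filter ProbabilityTheory
open Literature.MathematicalPhysics.QuantumFieldTheory
open Literature.MathematicalPhysics.QuantumLattice (fundamentalRep continuous_fundamentalRep fundamentalRep_apply
  fundamentalRep_mem_unitaryGroup LGConfig ZdPlaquette plaquettesTouching plaquetteEdges mem_plaquettesTouching_iff
  plaquetteObs isCylinder_plaquetteObs abs_plaquetteObs_le_holds wilsonBoundaryAction ymSpecification
  isProbabilityMeasure_ymSpecification)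
open Literature.Probability.LatticeModels (glueWith glueWith_apply_mem glueWith_apply_not_mem measurable_glueWith Site.supNorm
  Site.supNorm_le_iff Site.supNorm_add_le Site.norm_eq_supNorm)
open Literature.MathematicalPhysics.QuantumFieldTheory.SUNBakryEmery (SUN)

namespace Summit.Ventures.YMGap

namespace LatticeBakryEmery

variable {d N : ℕ}

/-! ### Kernel expectations of `E`-cylinders -/

/-- A cylinder observable over `E` built from a continuous `u` is continuous. -/
theorem continuous_matrixCylinder (E : Finset (Literature.MathematicalPhysics.QuantumFieldTheory.ZdEdge d))
    {u : Cfg ↥E N → ℝ} (hu : Continuous u) : Continuous (matrixCylinder E u) :=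
  hu.comp (continuous_pi fun e => continuous_subtype_val.comp (continuous_apply e.1))

/-- `matrixCylinder E u U = u (emb (U restricted to E))`. -/
theorem matrixCylinder_eq_emb (E : Finset (Literature.MathematicalPhysics.QuantumFieldTheory.ZdEdge d))
    (u : Cfg ↥E N → ℝ) (U : LGConfig d (SUN N)) :
    matrixCylinder E u U = u (emb fun e : ↥E => U e) := rfl

/-- Continuous functions are bounded on the compact group `SU(N)^E`. -/
theorem exists_abs_le_of_continuous_PSU {ι : Type} [Fintype ι] {φ : PSU ι N → ℝ} (hφ : Continuous φ) :
    ∃ C : ℝ, ∀ ζ, |φ ζ| ≤ C := by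
  obtain ⟨C, hC⟩ := isCompact_univ.exists_bound_of_continuousOn hφ.continuousOn
  exact ⟨C, fun ζ => by simpa [Real.norm_eq_abs] using hC ζ (Set.mem_univ _)⟩

/-- A cylinder observable over `E` built from a continuous `u` is bounded. -/
theorem exists_abs_matrixCylinder_le (E : Finset (Literature.MathematicalPhysics.QuantumFieldTheory.ZdEdge d))
    {u : Cfg ↥E N → ℝ} (hu : Continuous u) : ∃ C : ℝ, ∀ U : LGConfig d (SUN N), |matrixCylinder E u U| ≤ C := by
  obtain ⟨C, hC⟩ := exists_abs_le_of_continuous_PSU (ι := ↥E) (hu.comp continuous_emb)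
  exact ⟨C, fun U => by rw [matrixCylinder_eq_emb]; exact hC _⟩

/-- **Kernel expectations of `E`-cylinders as `e^{regionPot}`-weighted Haar averages**:
`∫ u((U_e)_{e∈E}) dγ_E(·|η) = ∫ e^{S_{E,η}} (u ∘ emb) dσ^{⊗E} / ∫ e^{S_{E,η}} dσ^{⊗E}`. -/
theorem integral_kernel_matrixCylinder (E : Finset (Literature.MathematicalPhysics.QuantumFieldTheory.ZdEdge d))
    (η : LGConfig d (SUN N)) (β : ℝ) {u : Cfg ↥E N → ℝ} (hu : Continuous u) :
    ∫ U, matrixCylinder E u U ∂(ymSpecification (fundamentalRep (Fin N)) ((N : ℝ) * β) E η) =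
      (∫ ζ, Real.exp (regionPot E η β (emb ζ)) * u (emb ζ) ∂(haarPi ↥E N)) /
        ∫ ζ, Real.exp (regionPot E η β (emb ζ)) ∂(haarPi ↥E N) := by
  rw [integral_ymSpecification_eq_div E η β (continuous_matrixCylinder E hu)]
  have hglue : ∀ ζ : PSU ↥E N, matrixCylinder E u (glueWith E ζ η) = u (emb ζ) := by
    intro ζ
    simp only [matrixCylinder]
    congr 1
    funext e
    rw [glueWith_apply_mem E ζ η e.2, emb_apply]
  simp only [hglue]

/-! ### Invisibility of the exterior beyond the collar -/

/-- If two exterior configurations agree at every link OUTSIDE `E` of every plaquette touching `E`,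
the kernel potentials coincide. -/
theorem regionPot_congr (E : Finset (Literature.MathematicalPhysics.QuantumFieldTheory.ZdEdge d))
    {η η' : LGConfig d (SUN N)} (β : ℝ)
    (h : ∀ p ∈ plaquettesTouching E, ∀ e ∈ plaquetteEdges p, e ∉ E → η e = η' e) :
    regionPot E η β = regionPot E η' β := by
  have hl : ∀ p ∈ plaquettesTouching E, ∀ e ∈ plaquetteEdges p, ∀ Q : Cfg ↥E N,
      linkOrExt E η Q e = linkOrExt E η' Q e := by
    intro p hp e he Q
    unfold linkOrExt
    split_ifs with heE
    · rfl
    · rw [h p hp e he heE]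
  have h1 : ∀ p : ZdPlaquette d, (p.1, p.2.1.1) ∈ plaquetteEdges p := fun p =>
    Finset.mem_insert_self _ _
  have h2 : ∀ p : ZdPlaquette d, (p.1 + Pi.single p.2.1.1 1, p.2.1.2) ∈ plaquetteEdges p := fun p =>
    Finset.mem_insert_of_mem (Finset.mem_insert_self _ _)
  have h3 : ∀ p : ZdPlaquette d, (p.1 + Pi.single p.2.1.2 1, p.2.1.1) ∈ plaquetteEdges p := fun p =>
    Finset.mem_insert_of_mem (Finset.mem_insert_of_mem (Finset.mem_insert_self _ _))
  have h4 : ∀ p : ZdPlaquette d, (p.1, p.2.1.2) ∈ plaquetteEdges p := fun p =>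
    Finset.mem_insert_of_mem (Finset.mem_insert_of_mem (Finset.mem_insert_of_mem (Finset.mem_singleton_self _)))
  have h0 : regionPot₀ (N := N) E η = regionPot₀ E η' := by
    funext Q
    unfold regionPot₀
    refine Finset.sum_congr rfl fun p hp => ?_
    rw [hl p hp _ (h1 p) Q, hl p hp _ (h2 p) Q, hl p hp _ (h3 p) Q, hl p hp _ (h4 p) Q]
  funext Q
  show (N : ℝ) * β * regionPot₀ E η Q = (N : ℝ) * β * regionPot₀ E η' Q
  rw [h0]

/-- **The kernel expectation of an `E`-cylinder depends on the exterior configuration only through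
the collar** `((plaquettesTouching E).biUnion plaquetteEdges) \ E`. -/
theorem kernel_integral_congr (E : Finset (Literature.MathematicalPhysics.QuantumFieldTheory.ZdEdge d))
    {η η' : LGConfig d (SUN N)} (β : ℝ)
    (h : ∀ e ∈ ((plaquettesTouching E).biUnion plaquetteEdges) \ E, η e = η' e)
    {u : Cfg ↥E N → ℝ} (hu : Continuous u) :
    ∫ U, matrixCylinder E u U ∂(ymSpecification (fundamentalRep (Fin N)) ((N : ℝ) * β) E η) =
      ∫ U, matrixCylinder E u U ∂(ymSpecification (fundamentalRep (Fin N)) ((N : ℝ) * β) E η') := by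
  have hS : regionPot E η β = regionPot (N := N) E η' β :=
    regionPot_congr E β fun p hp e he heE =>
      h e (Finset.mem_sdiff.2 ⟨Finset.mem_biUnion.2 ⟨p, hp, he⟩, heE⟩)
  rw [integral_kernel_matrixCylinder E η β hu, integral_kernel_matrixCylinder E η' β hu, hS]

/-! ### The exponential-tilt identity -/

/-- **Exponential tilting between boundary conditions.** For ANY two exterior configurations
`η, η'`, with the tilt `W = regionPot E η' β - regionPot E η β` and `G = e^W((U_e)_{e∈E})`:
`γ_E(F|η') - γ_E(F|η) = Cov_{γ_E(·|η)}(F, G) / γ_E(G|η)` for every continuous `E`-cylinder `F`. -/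
theorem kernel_integral_sub_eq_cov_div (E : Finset (Literature.MathematicalPhysics.QuantumFieldTheory.ZdEdge d))
    (η η' : LGConfig d (SUN N)) (β : ℝ) {u : Cfg ↥E N → ℝ} (hu : Continuous u) :
    ∫ U, matrixCylinder E u U ∂(ymSpecification (fundamentalRep (Fin N)) ((N : ℝ) * β) E η') -
        ∫ U, matrixCylinder E u U ∂(ymSpecification (fundamentalRep (Fin N)) ((N : ℝ) * β) E η) =
      cov[matrixCylinder E u, matrixCylinder E (fun Q => Real.exp (regionPot E η' β Q - regionPot E η β Q));
          ymSpecification (fundamentalRep (Fin N)) ((N : ℝ) * β) E η] /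
        ∫ U, matrixCylinder E (fun Q => Real.exp (regionPot E η' β Q - regionPot E η β Q)) U
          ∂(ymSpecification (fundamentalRep (Fin N)) ((N : ℝ) * β) E η) := by
  haveI : IsProbabilityMeasure (ymSpecification (fundamentalRep (Fin N)) ((N : ℝ) * β) E η) :=
    isProbabilityMeasure_ymSpecification (fundamentalRep (Fin N)) (continuous_fundamentalRep (Fin N)) _ E η
  have hSc : ContDiff ℝ ∞ (regionPot (N := N) E η β) := contDiff_regionPot E η β
  have hS'c : ContDiff ℝ ∞ (regionPot (N := N) E η' β) := contDiff_regionPot E η' β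
  have hg : Continuous fun Q : Cfg ↥E N => Real.exp (regionPot E η' β Q - regionPot E η β Q) :=
    Real.continuous_exp.comp (hS'c.continuous.sub hSc.continuous)
  have hug : Continuous fun Q : Cfg ↥E N => u Q * Real.exp (regionPot E η' β Q - regionPot E η β Q) :=
    hu.mul hg
  have hZpos : 0 < ∫ ζ, Real.exp (regionPot E η β (emb ζ)) ∂(haarPi ↥E N) :=
    integral_exp_pos (integrable_of_continuous_PSU (Real.continuous_exp.comp (continuous_restrict hSc)) _)
  have hZ'pos : 0 < ∫ ζ, Real.exp (regionPot E η' β (emb ζ)) ∂(haarPi ↥E N) :=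
    integral_exp_pos (integrable_of_continuous_PSU (Real.continuous_exp.comp (continuous_restrict hS'c)) _)
  -- `e^{S} · e^{W} = e^{S'}`
  have hSg : ∀ ζ : PSU ↥E N, Real.exp (regionPot E η β (emb ζ)) *
      Real.exp (regionPot E η' β (emb ζ) - regionPot E η β (emb ζ)) = Real.exp (regionPot E η' β (emb ζ)) := by
    intro ζ
    rw [← Real.exp_add]
    congr 1
    ring
  have i3 : ∫ ζ, Real.exp (regionPot E η β (emb ζ)) * Real.exp (regionPot E η' β (emb ζ) - regionPot E η β (emb ζ))
      ∂(haarPi ↥E N) = ∫ ζ, Real.exp (regionPot E η' β (emb ζ)) ∂(haarPi ↥E N) :=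
    integral_congr_ae (ae_of_all _ fun ζ => hSg ζ)
  have i4 : ∫ ζ, Real.exp (regionPot E η β (emb ζ)) *
      (u (emb ζ) * Real.exp (regionPot E η' β (emb ζ) - regionPot E η β (emb ζ))) ∂(haarPi ↥E N) =
      ∫ ζ, Real.exp (regionPot E η' β (emb ζ)) * u (emb ζ) ∂(haarPi ↥E N) := by
    refine integral_congr_ae (ae_of_all _ fun ζ => ?_)
    simp only
    rw [← hSg ζ]
    ring
  -- the covariance as `∫FG - ∫F ∫G`
  obtain ⟨Cu, hCu⟩ := exists_abs_matrixCylinder_le (N := N) E hu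
  obtain ⟨Cg, hCg⟩ := exists_abs_matrixCylinder_le (N := N) E hg
  have hmu : MemLp (matrixCylinder E u) 2 (ymSpecification (fundamentalRep (Fin N)) ((N : ℝ) * β) E η) :=
    MemLp.of_bound (continuous_matrixCylinder E hu).aestronglyMeasurable Cu
      (ae_of_all _ fun U => by rw [Real.norm_eq_abs]; exact hCu U)
  have hmg : MemLp (matrixCylinder E fun Q : Cfg ↥E N => Real.exp (regionPot E η' β Q - regionPot E η β Q)) 2
      (ymSpecification (fundamentalRep (Fin N)) ((N : ℝ) * β) E η) :=
    MemLp.of_bound (continuous_matrixCylinder E hg).aestronglyMeasurable Cg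
      (ae_of_all _ fun U => by rw [Real.norm_eq_abs]; exact hCg U)
  have hprod : (matrixCylinder E u * matrixCylinder E fun Q : Cfg ↥E N =>
      Real.exp (regionPot E η' β Q - regionPot E η β Q) : LGConfig d (SUN N) → ℝ) =
      matrixCylinder E (fun Q => u Q * Real.exp (regionPot E η' β Q - regionPot E η β Q)) := by
    funext U; rfl
  rw [covariance_eq_sub hmu hmg, hprod, integral_kernel_matrixCylinder E η' β hu,
    integral_kernel_matrixCylinder E η β hu, integral_kernel_matrixCylinder E η β hug,
    integral_kernel_matrixCylinder E η β hg, i3, i4]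
  have hZne := hZpos.ne'
  have hZ'ne := hZ'pos.ne'
  field_simp

/-- **The tilt bound.** If the tilt is bounded, `|regionPot E η' β - regionPot E η β| ≤ w` on
`SU(N)^E`, then `|γ_E(F|η') - γ_E(F|η)| ≤ e^{w} · |Cov_{γ_E(·|η)}(F, e^W)|`. -/
theorem abs_kernel_integral_sub_le (E : Finset (Literature.MathematicalPhysics.QuantumFieldTheory.ZdEdge d))
    (η η' : LGConfig d (SUN N)) (β : ℝ) {u : Cfg ↥E N → ℝ} (hu : Continuous u) {w : ℝ}
    (hw : ∀ ζ : PSU ↥E N, |regionPot E η' β (emb ζ) - regionPot E η β (emb ζ)| ≤ w) :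
    |∫ U, matrixCylinder E u U ∂(ymSpecification (fundamentalRep (Fin N)) ((N : ℝ) * β) E η') -
        ∫ U, matrixCylinder E u U ∂(ymSpecification (fundamentalRep (Fin N)) ((N : ℝ) * β) E η)| ≤
      Real.exp w *
        |cov[matrixCylinder E u, matrixCylinder E (fun Q => Real.exp (regionPot E η' β Q - regionPot E η β Q));
          ymSpecification (fundamentalRep (Fin N)) ((N : ℝ) * β) E η]| := by
  set γ := ymSpecification (fundamentalRep (Fin N)) ((N : ℝ) * β) E η with hγ
  haveI : IsProbabilityMeasure γ :=
    isProbabilityMeasure_ymSpecification (fundamentalRep (Fin N)) (continuous_fundamentalRep (Fin N)) _ E η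
  set g : Cfg ↥E N → ℝ := fun Q => Real.exp (regionPot E η' β Q - regionPot E η β Q) with hgdef
  have hg : Continuous g := Real.continuous_exp.comp
    ((contDiff_regionPot E η' β).continuous.sub (contDiff_regionPot E η β).continuous)
  -- `γ(G) ≥ e^{-w} > 0`
  have hGge : Real.exp (-w) ≤ ∫ U, matrixCylinder E g U ∂γ := by
    have hGi : Integrable (matrixCylinder E g) γ := by
      obtain ⟨Cg, hCg⟩ := exists_abs_matrixCylinder_le (N := N) E hg
      exact Integrable.of_bound (continuous_matrixCylinder E hg).aestronglyMeasurable Cg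
        (ae_of_all _ fun U => by rw [Real.norm_eq_abs]; exact hCg U)
    have hc : ∫ _U, Real.exp (-w) ∂γ = Real.exp (-w) := by
      rw [integral_const, smul_eq_mul, probReal_univ, one_mul]
    rw [← hc]
    refine integral_mono (integrable_const _) hGi fun U => ?_
    rw [matrixCylinder_eq_emb]
    simp only [hgdef]
    refine Real.exp_le_exp.2 ?_
    have := hw (fun e : ↥E => U e)
    exact (abs_le.1 this).1 |> fun h => by linarith
  have hGpos : 0 < ∫ U, matrixCylinder E g U ∂γ := lt_of_lt_of_le (Real.exp_pos _) hGge
  rw [kernel_integral_sub_eq_cov_div E η η' β hu, abs_div, abs_of_pos hGpos, div_le_iff₀ hGpos]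
  calc |cov[matrixCylinder E u, matrixCylinder E g; γ]|
      = Real.exp w * |cov[matrixCylinder E u, matrixCylinder E g; γ]| * Real.exp (-w) := by
        rw [mul_comm (Real.exp w), mul_assoc, ← Real.exp_add, add_neg_cancel, Real.exp_zero, mul_one]
    _ ≤ Real.exp w * |cov[matrixCylinder E u, matrixCylinder E g; γ]| * ∫ U, matrixCylinder E g U ∂γ :=
        mul_le_mul_of_nonneg_left hGge (mul_nonneg (Real.exp_pos _).le (abs_nonneg _))

end LatticeBakryEmery

end Summit.Ventures.YMGap
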